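import Summits.MatrixMultiplication.OmegaCensus.STPPVosperSlackOneBetaCover
import Summits.MatrixMultiplication.OmegaCensus.STPPVosperCoverRuns

/-!
# ω-census (abelian STPP census): the β row checker with RUN certificates (kernel)

HONEST FRAMING (pub-omega census; verbatim): lottery ticket; floor = certified bounds/negative ranges.
Census STRUCTURE (seat pub-omega-stpp-1 gen 31, 2026-08-28), family (b2).  `bCoverRow` (`STPPVosperSlackOneBetaCover.lean`) discharges the case-β
hypothesis `hspecβ` of the law `no_isSTPP_of_slack_one_tables_prime_a2_coverSpecB` by EVALUATING the exact-cover search `existsCoverZ` at every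
surviving configuration — too expensive in the kernel when the point lists are interval-like.  `bCoverRowR` is the same row with a list of RUN
CERTIFICATES `(w₀, D, runs)` tried first (`runsCert`, `STPPVosperCoverRuns.lean`: a valid certificate PROVES `existsCoverZ … = false` without search);
only if no certificate checks is the search evaluated.  `bCoverRowR_spec` has the same conclusion as `bCoverRow_spec`.  Pure finite bookkeeping;
nothing here is progress on `ω`.
-/

open Finset

namespace Summit.MatrixMultiplication.OmegaCensus.CubeNB

/-- **One row (`j` fixed) of the case-β table with run certificates and the exact-cover stage** (`Bool`): as `bCoverRow p n₁ m b J L blocks j`, but a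
surviving configuration `(t, hh, g₀)` is also admissible when one of the certificates `certs` (each `(w₀, D, runs)`) passes `runsCert` for the point lists
`[(j k) mod p : k < L]`, `ZLof p (n₁ − 1) b hh g₀`. [folklore] -/
def bCoverRowR (p n₁ m b : ℕ) (J : Finset ℕ) (L : ℕ) (blocks : List (ℕ × ℕ × ℕ)) (certs : List (ℕ × ℕ × List (ℕ × ℕ))) (j : ℕ) : Bool :=
  (List.range p).all fun t =>
    decide (j ∈ J) ||
    !((List.range m).all fun i => decide ((t + j * i) % p < n₁)) ||
    (List.range n₁).all fun h =>
      decide (h ∈ (range m).image fun i => (t + j * i) % p) ||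
      (List.range b).all fun g₀ =>
        !(greedyTiles ((range (b + 1)).erase (g₀ + 1)) n₁
            (((range n₁).erase h).filter fun x => x ∉ (range m).image fun i => (t + j * i) % p)) ||
        (certs.any fun ce => runsCert p ((List.range L).map fun k => (j * k) % p) (ZLof p (n₁ - 1) b h g₀) blocks ce.1 ce.2.1 ce.2.2) ||
        !(existsCoverZ p ((List.range L).map fun k => (j * k) % p) (ZLof p (n₁ - 1) b h g₀) blocks [] [])

/-- **Specification of the β row checker with run certificates** (same conclusion as `bCoverRow_spec`). [folklore] -/
theorem bCoverRowR_spec {p n₁ m b : ℕ} {J : Finset ℕ} {L : ℕ} {blocks : List (ℕ × ℕ × ℕ)} {certs : List (ℕ × ℕ × List (ℕ × ℕ))} {j : ℕ}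
    (h : bCoverRowR p n₁ m b J L blocks certs j = true) :
    ∀ t < p, (∀ i < m, (t + j * i) % p < n₁) → ∀ hh < n₁, hh ∉ (range m).image (fun i => (t + j * i) % p) →
      ∀ g₀ < b, greedyTiles ((range (b + 1)).erase (g₀ + 1)) n₁
        (((range n₁).erase hh).filter fun x => x ∉ (range m).image fun i => (t + j * i) % p) = true →
      j ∈ J ∨ existsCoverZ p ((List.range L).map fun k => (j * k) % p) (ZLof p (n₁ - 1) b hh g₀) blocks [] [] = false := by
  intro t ht hwin hh hhh hhole g₀ hg₀ htile
  rw [bCoverRowR, List.all_eq_true] at h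
  have h1 := h t (List.mem_range.2 ht)
  rw [Bool.or_eq_true, Bool.or_eq_true, decide_eq_true_eq] at h1
  rcases h1 with (hJ | hw) | h1
  · exact Or.inl hJ
  · exfalso
    rw [Bool.not_eq_true', Bool.eq_false_iff] at hw
    apply hw
    rw [List.all_eq_true]
    intro i hi
    rw [decide_eq_true_eq]
    exact hwin i (List.mem_range.1 hi)
  rw [List.all_eq_true] at h1
  have h2 := h1 hh (List.mem_range.2 hhh)
  rw [Bool.or_eq_true, decide_eq_true_eq] at h2
  rcases h2 with hmem | h2
  · exact absurd hmem hhole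
  rw [List.all_eq_true] at h2
  have h3 := h2 g₀ (List.mem_range.2 hg₀)
  rw [Bool.or_eq_true, Bool.or_eq_true, Bool.not_eq_true', Bool.not_eq_true'] at h3
  rcases h3 with (h4 | h4) | h4
  · rw [htile] at h4; exact Bool.noConfusion h4
  · rw [List.any_eq_true] at h4
    obtain ⟨ce, -, hce⟩ := h4
    exact Or.inr (existsCoverZ_false_of_runsCert hce)
  · exact Or.inr h4

end Summit.MatrixMultiplication.OmegaCensus.CubeNB
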